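import Summits.CriticalPhenomena.CardyFormulaZ2.Theorems.CardyPolygonWordsAssembly
import Summits.CriticalPhenomena.CardyFormulaZ2.Theorems.CardyComplexConeSLESixFamiliesGiveCardyModulusContinuity

/-!
# Stub `stub_lowerPolyominoSandwich` of line `registered` (crux `PolyominoToJordan`, stmt-CriticalPhenomena-14338)

Crux `Summit.CriticalPhenomena.CardyFormulaZ2.Theses.CardyTensorRG.PolyominoToJordan`, line
`registered` (`Lines/birth.lean`), stub `stub_lowerPolyominoSandwich`: the **lower polyomino
sandwich with modulus control**.  For every conformal rectangle `R` with uniformizing datum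
`(φ, x)` and every `ε > 0` there is a POLYOMINO conformal rectangle `P` (carrier = interior of a
finite union of closed `δ₀`-cells, marked points on `δ₀ℤ²`) carrying a uniformizing datum `(ψ, y)`
with `|crossRatio y - crossRatio x| ≤ ε`, which is crossed at most `ε` more often than `R` for all
small meshes: `bond P δ ≤ bond R δ + ε` eventually as `δ → 0⁺` (in fact `bond P δ ≤ bond R δ`).

Proof.  An `F`-free re-run of the `hlow` block of
`LatticePolygonApproximation.cardyFormulaZ2_of_cardyLatticePolygon`
(`Theorems/CardyPolygonWordsAssembly.lean`): Radó continuity of the modulus in the `ε`-form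
(`CollarTouchSandwich.stub_modulusContinuity`, shift `c = 0`) gives `ε₁`; the lower comparison
quad `Q` of `stub_comparisonGeometry R (ε₁/2)` at the plate margin `t₀` of
`stub_discreteCrossing_of_pathIn R` has room `r`; the lattice-polygon approximant `P` of `Q`
(`exists_latticePolygon_close`, loop `min (ε₁/2) (r/4)`-close, marks `min (ε₁/2) τ₀`-close with
`τ₀` the `r/2`-modulus of uniform continuity of `∂Q`) is the polyomino; re-marking `Q` with the
marks of `P` moves its arcs within `r/2` (`arc_subset_cthickening_arc_of_marks`), so the comparison
clauses hold with room `r/2` and `discreteCrossing_subset_of_lower` gives the inclusion of the G02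
crossing events, whence `bond P δ ≤ bond R δ`; the loop and marks of `P` are `ε₁`-close to those
of `R` by the triangle inequality through `Q`, so every uniformizing datum of `P` has cross-ratio
`ε`-close to `crossRatio x`.

References: B. Bollobás, O. Riordan, *Percolation* (2006), Ch. 7 Lemma 14 p. 184, Claim 19
p. 192; Ch. Pommerenke, *Boundary Behaviour of Conformal Maps* (1992), Thm. 2.11 (Radó).
-/

noncomputable section

namespace Summit.CriticalPhenomena.CardyFormulaZ2.Cruxes.PolyominoToJordan.Birth

open Set Metric Filter Topology MeasureTheory
open Literature.Probability.LatticeModels Literature.Probability.Percolation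
open Literature.Probability.RandomPlanarGeometry
open Summit.CriticalPhenomena.CardyFormulaZ2.Cruxes.LoopsToCrossings.OracleSandwich
  (stub_discreteCrossing_of_pathIn stub_comparisonGeometry)
open Summit.CriticalPhenomena.CardyFormulaZ2.Theorems.RectilinearApproximation
  (discreteCrossing_subset_of_lower)
open Summit.CriticalPhenomena.CardyFormulaZ2.Theorems.LatticePolygonApproximation
  (arc_subset_cthickening_arc_of_marks exists_latticePolygon_close)
open Summit.CriticalPhenomena.CardyFormulaZ2.Cruxes.SLESixFamiliesGiveCardy.CollarTouchSandwich
  (stub_modulusContinuity)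

/-- **Lower polyomino sandwich with modulus control** (Bollobás–Riordan 2006 Ch. 7 Lemma 14 +
Claim 19, lower half, for bond-`ℤ²` in the G02 discretisation, with a LATTICE-POLYGON comparison
domain carrying LATTICE marks; modulus clause by Radó).  For every conformal rectangle `R` with
uniformizing datum `(φ, x)` and every `ε > 0` there is a polyomino conformal rectangle `P` with a
uniformizing datum `(ψ, y)` such that `|crossRatio y - crossRatio x| ≤ ε` and, eventually as
`δ → 0⁺`, `bond P δ ≤ bond R δ + ε`.  See the module docstring.
[cite: BollobasRiordan2006, Ch. 7 Lemma 14 p. 184] -/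
theorem stub_lowerPolyominoSandwich :
    ∀ (R : Literature.Probability.RandomPlanarGeometry.ConformalRectangle)
      (φ : Literature.Probability.RandomPlanarGeometry.ConformalEquiv
        UpperHalfPlane.upperHalfPlaneSet R.carrier)
      (x : Fin 4 → ℝ), R.IsUniformizing φ x → ∀ ε : ℝ, 0 < ε →
      ∃ P : Literature.Probability.RandomPlanarGeometry.ConformalRectangle,
        (∃ δ₀ : ℝ, 0 < δ₀ ∧ (∃ s : Finset (ℤ × ℤ), P.carrier = interior (⋃ p ∈ s,
          {z : ℂ | δ₀ * (p.1 : ℝ) ≤ z.re ∧ z.re ≤ δ₀ * ((p.1 : ℝ) + 1) ∧ δ₀ * (p.2 : ℝ) ≤ z.im ∧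
            z.im ≤ δ₀ * ((p.2 : ℝ) + 1)})) ∧
          ∀ i, ∃ m n : ℤ, P.pt i = (δ₀ : ℂ) * ((m : ℂ) + (n : ℂ) * Complex.I)) ∧
        (∃ (ψ : Literature.Probability.RandomPlanarGeometry.ConformalEquiv
            UpperHalfPlane.upperHalfPlaneSet P.carrier) (y : Fin 4 → ℝ),
          P.IsUniformizing ψ y ∧
            |Literature.Probability.RandomPlanarGeometry.crossRatio y -
              Literature.Probability.RandomPlanarGeometry.crossRatio x| ≤ ε) ∧
        ∀ᶠ δ : ℝ in nhdsWithin 0 (Set.Ioi 0),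
          Literature.Probability.Percolation.bondDomainCrossingProb P δ ≤
            Literature.Probability.Percolation.bondDomainCrossingProb R δ + ε := by
  intro R φ x hux ε hε
  -- Radó: `ε₁`-close loops and marks give `ε`-close cross-ratios
  obtain ⟨ε₁, hε₁, h1⟩ := stub_modulusContinuity R φ x hux ε hε
  -- the lower comparison quad `Q` with room `r`, and the stub-A constants `δ₀, t₀`
  obtain ⟨m, hm, hgeo⟩ := stub_comparisonGeometry R (ε₁ / 2) (by positivity)
  obtain ⟨δ₀, hδ₀, t₀, ht₀, hAfor⟩ := stub_discreteCrossing_of_pathIn R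
  obtain ⟨⟨Q, r, hr, hQb, hQm, hL1, hL2, hL3, hL4⟩, -⟩ := hgeo t₀ ht₀
  -- uniform continuity of `∂Q` at scale `r/2`
  obtain ⟨τ₀, hτ₀, -, hτ₀c⟩ :=
    Q.toJordanDomain.exists_forall_dist_boundary_lt (ε := r / 2) (by positivity)
  -- the lattice-polygon approximant `P` of `Q` (the polyomino)
  obtain ⟨P, d, hd, hPcell, hPpt, hPmark, hPclose⟩ :=
    exists_latticePolygon_close Q (ε := min (ε₁ / 2) (r / 4)) (τ := min (ε₁ / 2) τ₀)
      (lt_min (by positivity) (by positivity)) (lt_min (by positivity) hτ₀)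
  -- the re-marked lower quad
  set Q' : ConformalRectangle := ⟨Q.toJordanDomain, P.mark, P.strictMono_mark, P.mark_mem⟩ with hQ'
  have harc : ∀ i, Q'.arc i ⊆ cthickening (r / 2) (Q.arc i) := fun i =>
    arc_subset_cthickening_arc_of_marks Q Q' rfl
      (fun j => (hPmark j).trans (min_le_right _ _)) hτ₀c i
  have hthick : ∀ i, cthickening (r / 2) (Q'.arc i) ⊆ cthickening r (Q.arc i) := by
    intro i z hz
    have h1 := cthickening_subset_of_subset (r / 2) (harc i) hz
    have h2 := cthickening_cthickening_subset (by positivity : (0 : ℝ) ≤ r / 2)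
      (by positivity : (0 : ℝ) ≤ r / 2) (Q.arc i) h1
    rwa [add_halves] at h2
  have hL1' : ∀ z ∈ cthickening (r / 2) Q'.carrier, z ∉ R.carrier →
      infDist z (R.arc 0) ≤ t₀ ∨ infDist z (R.arc 2) ≤ t₀ :=
    fun z hz => hL1 z (cthickening_mono (by linarith) _ hz)
  have hL2' : ∀ z ∈ cthickening (r / 2) Q'.carrier, z ∈ R.carrier →
      m ≤ infDist z (R.arc 1) ∧ m ≤ infDist z (R.arc 3) :=
    fun z hz => hL2 z (cthickening_mono (by linarith) _ hz)
  have hL3' : ∀ z ∈ cthickening (r / 2) (Q'.arc 0), z ∉ R.carrier ∧ infDist z (R.arc 0) ≤ t₀ :=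
    fun z hz => hL3 z (hthick 0 hz)
  have hL4' : ∀ z ∈ cthickening (r / 2) (Q'.arc 2), z ∉ R.carrier ∧ infDist z (R.arc 2) ≤ t₀ :=
    fun z hz => hL4 z (hthick 2 hz)
  -- a uniformizing datum of `P`
  obtain ⟨ψ, y, hψ⟩ := MarkedDomain.exists_isUniformizing_holds P
  refine ⟨P, ⟨d, hd, hPcell, hPpt⟩, ⟨ψ, y, hψ, ?_⟩, ?_⟩
  · -- modulus clause: the loop and marks of `P` are `ε₁`-close to those of `R` (shift `0`)
    refine h1 P 0 (fun u => ?_) (fun i => ?_) ψ y hψ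
    · rw [add_zero]
      calc dist (P.boundary u) (R.boundary u)
          ≤ dist (P.boundary u) (Q.boundary u) + dist (Q.boundary u) (R.boundary u) :=
            dist_triangle _ _ _
        _ ≤ min (ε₁ / 2) (r / 4) + ε₁ / 2 := add_le_add (hPclose u) (hQb u)
        _ ≤ ε₁ := by have := min_le_left (ε₁ / 2) (r / 4); linarith
    · rw [add_zero]
      calc |P.mark i - R.mark i| ≤ |P.mark i - Q.mark i| + |Q.mark i - R.mark i| := abs_sub_le _ _ _
        _ ≤ min (ε₁ / 2) τ₀ + ε₁ / 2 := add_le_add (hPmark i) (hQm i)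
        _ ≤ ε₁ := by have := min_le_left (ε₁ / 2) τ₀; linarith
  · -- comparison clause: `bond P δ ≤ bond R δ` for all small meshes
    have hev : ∀ᶠ δ : ℝ in 𝓝[>] 0, δ ∈ Ioo 0 (min δ₀ (min m (r / 4))) :=
      Ioo_mem_nhdsGT (lt_min hδ₀ (lt_min hm (by positivity)))
    filter_upwards [hev] with δ hδ
    have hδ₀' : δ < δ₀ := hδ.2.trans_le (min_le_left _ _)
    have hδm : δ < m := hδ.2.trans_le ((min_le_right _ _).trans (min_le_left _ _))
    have hδr : δ < r / 4 := hδ.2.trans_le ((min_le_right _ _).trans (min_le_right _ _))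
    have hincl := discreteCrossing_subset_of_lower R Q' P hAfor hL1' hL2' hL3' hL4' hPclose
      (fun _ => rfl) (le_min (by positivity) (by positivity))
      (by have := min_le_right (ε₁ / 2) (r / 4); linarith) hδ.1 hδ₀' hδm (by linarith) ht₀.le
    have hle : bondDomainCrossingProb P δ ≤ bondDomainCrossingProb R δ := by
      rw [bondDomainCrossingProb_eq_measureReal, bondDomainCrossingProb_eq_measureReal]
      exact measureReal_mono hincl
    linarith

end Summit.CriticalPhenomena.CardyFormulaZ2.Cruxes.PolyominoToJordan.Birth

end
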